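import Summits.AtomisticToContinuum.FouriersLaw.Theses.EmbeddedDrudeMourre
import Summits.AtomisticToContinuum.FouriersLaw.Theorems.EmbeddedDrudeMourreMourreDissolutionPoissonLocallyUniform
import Summits.AtomisticToContinuum.FouriersLaw.Theorems.EmbeddedDrudeMourreMourreDissolutionPoissonWindowInversion
import Literature.MathematicalPhysics.KineticTheory.ZeroWavenumberSpace
import Literature.MathematicalPhysics.KineticTheory.InfiniteChainInvariantStates
import Literature.MathematicalPhysics.KineticTheory.InfiniteChainSuperstableDynamics
import HarnessLib

/-!
# Stub K `stub_freeForceKernel`, reduction to the spectral window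
(line `gram-pencil-harmonic-chaos`, crux `EmbeddedDrudeMourre.DrudeDissolution`,
item stmt-AtomisticToContinuum-12593; `--supports` file, closes nothing)

WHAT. The conclusion of stub K is an Abelian (Poisson) boundary-value statement about the cosine
transform of a finite measure. This file isolates the real analysis:

* `tendstoLocallyUniformlyOn_abelCos_of_window` (registered helper): if `K t = ∫ cos(xt) dm(x)` for a
  finite measure `m` which on the window `(-δ, δ)` is `ρ dx` with `ρ ≥ 0` continuous, then the
  Abel–cosine transforms `A_ν(ω) = ∫_{t>0} e^{-νt} cos(ωt) K(t) dt` converge to `π(ρ(ω) + ρ(-ω))/2`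
  LOCALLY UNIFORMLY on `(-δ, δ)` as `ν ↓ 0` (no symmetry of `m` assumed: the cosine transform only sees
  the symmetrisation of `m`);
* `stub_freeForceKernel_of_spectralWindow`: stub K follows from its SPECTRAL FORM — the free force
  kernel `K₀(t) = Z₀.form Φ (Φ ∘ φ⁰_t)` is the cosine transform of a finite measure having near
  frequency `0` a continuous non-negative density, positive at `0` — which is what the Wick/normal-mode
  computation and the threshold analysis of the line's plan deliver.

HOW. `A_ν(ω) = ½(P_ν(ω) + P_ν(-ω))`, `P_ν(E) = ∫ ν/((x-E)²+ν²) dm(x)` (product formula and Fubini: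
`MourreDissolution.integral_exp_neg_mul_cos_mul_cosTransform`, `integral_symm`), and `P_ν → πρ`
locally uniformly on the window (`MourreDissolution.stub_poissonLocallyUniform`, landed stub B2 of the
sibling crux); the reflected copy converges by composition with `ω ↦ -ω`, which preserves the window.
-/

noncomputable section

open MeasureTheory Filter Set Function Topology
open scoped InnerProductSpace ENNReal NNReal
open Literature.MathematicalPhysics.KineticTheory
open Literature.MathematicalPhysics.KineticTheory.HeatConduction
open Literature.MathematicalPhysics.KineticTheory.PhononBoltzmann

namespace Summit.AtomisticToContinuum.FouriersLaw.Theorems.DrudeDissolution.GramPencilHarmonicChaos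

/-- **Poisson form of the Abel–cosine transform.** For a finite measure `m` with cosine transform
`K` and `ν > 0`: `∫_{t>0} e^{-νt} cos(ωt) K(t) dt = ½(P_ν(ω) + P_ν(-ω))`,
`P_ν(E) = ∫ ν/((x - E)² + ν²) dm(x)`. [folklore] -/
theorem abelCos_eq_half_add_poisson (m : Measure ℝ) [IsFiniteMeasure m] {K : ℝ → ℝ}
    (hK : ∀ t : ℝ, K t = ∫ x, Real.cos (x * t) ∂m) {ν : ℝ} (hν : 0 < ν) (ω : ℝ) :
    ∫ t in Ioi (0 : ℝ), Real.exp (-(ν * t)) * (Real.cos (ω * t) * K t) =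
      2⁻¹ * ((∫ x, ν / ((x - ω) ^ 2 + ν ^ 2) ∂m) + ∫ x, ν / ((x - -ω) ^ 2 + ν ^ 2) ∂m) := by
  have h1 : ∫ t in Ioi (0 : ℝ), Real.exp (-(ν * t)) * (Real.cos (ω * t) * K t) =
      ∫ t in Ioi (0 : ℝ), Real.exp (-(ν * t)) * Real.cos (ω * t) * K t :=
    integral_congr_ae (ae_of_all _ (fun t => (mul_assoc _ _ _).symm))
  have hcont : Continuous fun x : ℝ => ν / ((x - ω) ^ 2 + ν ^ 2) :=
    continuous_const.div (by fun_prop) (fun x => by positivity)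
  rw [h1, MourreDissolution.integral_exp_neg_mul_cos_mul_cosTransform m hK hν ω,
    MourreDissolution.integral_symm m hcont (fun x => MourreDissolution.norm_poisson_le hν (x - ω))]
  congr 2
  refine integral_congr_ae (ae_of_all _ (fun x => ?_))
  ring

/-- **Registered helper (stub K, reduction): locally uniform Abelian boundary values of a cosine
transform on a window carrying a continuous density.** If `K t = ∫ cos(xt) dm(x)` for a finite
measure `m` with `m|_(−δ,δ) = ρ dx`, `ρ ≥ 0` continuous on `(−δ, δ)`, then
`ω ↦ ∫_{t>0} e^{−νt} cos(ωt) K(t) dt → π(ρ(ω) + ρ(−ω))/2` locally uniformly on `(−δ, δ)` as `ν ↓ 0`.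
[folklore] -/
theorem tendstoLocallyUniformlyOn_abelCos_of_window : ∀ (m : MeasureTheory.Measure ℝ), MeasureTheory.IsFiniteMeasure m → ∀ (K : ℝ → ℝ), (∀ t : ℝ, K t = ∫ x, Real.cos (x * t) ∂m) → ∀ δ : ℝ, 0 < δ → ∀ ρ : ℝ → ℝ, ContinuousOn ρ (Set.Ioo (-δ) δ) → (∀ x ∈ Set.Ioo (-δ) δ, 0 ≤ ρ x) → m.restrict (Set.Ioo (-δ) δ) = (MeasureTheory.volume.restrict (Set.Ioo (-δ) δ)).withDensity (fun x => ENNReal.ofReal (ρ x)) → TendstoLocallyUniformlyOn (fun (ν : ℝ) (ω : ℝ) => ∫ t in Set.Ioi (0 : ℝ), Real.exp (-(ν * t)) * (Real.cos (ω * t) * K t)) (fun ω => Real.pi * ((ρ ω + ρ (-ω)) / 2)) (nhdsWithin 0 (Set.Ioi 0)) (Set.Ioo (-δ) δ) := by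
  intro m hm K hK δ hδ ρ hρc hρ0 hwin
  haveI := hm
  -- the Poisson integrals of `m` converge locally uniformly on the window (sibling stub B2)
  have hP := MourreDissolution.stub_poissonLocallyUniform m hm δ hδ ρ hρc hρ0 hwin
  -- the reflected copy: compose with `ω ↦ -ω`, which preserves the window
  have hmaps : MapsTo (fun ω : ℝ => -ω) (Ioo (-δ) δ) (Ioo (-δ) δ) := by
    intro ω hω
    exact ⟨by linarith [hω.2], by linarith [hω.1]⟩
  have hPneg := hP.comp (fun ω : ℝ => -ω) hmaps continuous_neg.continuousOn
  have hsum := hP.add hPneg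
  have hhalf := (uniformContinuous_mul_left' (2⁻¹ : ℝ)).comp_tendstoLocallyUniformlyOn hsum
  refine (hhalf.congr_inseparable ?_).congr_right ?_
  · filter_upwards [self_mem_nhdsWithin] with ν hν
    intro ω _
    refine Inseparable.of_eq ?_
    simp only [Function.comp_apply, Pi.add_apply]
    exact (abelCos_eq_half_add_poisson m hK hν ω).symm
  · intro ω _
    simp only [Function.comp_apply, Pi.add_apply]
    ring

/-- **Stub K from its spectral form.** If, for the data of stub K, the free force kernel
`K₀(t) = Z₀.form Φ (Φ ∘ φ⁰_t)` is the cosine transform of a finite measure which, on a window around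
frequency `0`, has a continuous non-negative density, positive at `0`, then the conclusion of stub K
holds (with the symmetrised density). Pure logic over `tendstoLocallyUniformlyOn_abelCos_of_window`.
[folklore] -/
theorem stub_freeForceKernel_of_spectralWindow
    (hres : ∀ ω₂ a b : ℝ, 0 < ω₂ → 0 < a → 0 < b → HasOddSectorGap ω₂ a b →
      ∀ (D₀ : InfiniteChainDynamics (pinnedChain ω₂ 0 0 1)) (Z₀ : ZeroWavenumberData (pinnedChain ω₂ 0 0 1) D₀),
        (pinnedChain ω₂ 0 0 1).IsChainGibbsMeasure 1 Z₀.μ →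
        D₀.carrier = (pinnedChain ω₂ 0 0 1).bmGood →
        Z₀.toFluctuationDynamics.IsStronglyContinuous →
        (fun σ : ChainConfig => liouvilleZ (pinnedChain ω₂ a b 1) (fun σ => (pinnedChain ω₂ 0 0 1).bondCurrentZ σ 0) σ - liouvilleZ (pinnedChain ω₂ 0 0 1) (fun σ => (pinnedChain ω₂ 0 0 1).bondCurrentZ σ 0) σ + b * (liouvilleZ (pinnedChain ω₂ 0 0 1) (fun σ => (pinnedChain ω₂ 0 1 1).bondCurrentZ σ 0) σ - liouvilleZ (pinnedChain ω₂ 0 0 1) (fun σ => (pinnedChain ω₂ 0 0 1).bondCurrentZ σ 0) σ)) ∈ Z₀.localObs →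
        ∃ m : Measure ℝ, IsFiniteMeasure m ∧
          (∀ t : ℝ, Z₀.form
                (fun σ : ChainConfig => liouvilleZ (pinnedChain ω₂ a b 1) (fun σ => (pinnedChain ω₂ 0 0 1).bondCurrentZ σ 0) σ - liouvilleZ (pinnedChain ω₂ 0 0 1) (fun σ => (pinnedChain ω₂ 0 0 1).bondCurrentZ σ 0) σ + b * (liouvilleZ (pinnedChain ω₂ 0 0 1) (fun σ => (pinnedChain ω₂ 0 1 1).bondCurrentZ σ 0) σ - liouvilleZ (pinnedChain ω₂ 0 0 1) (fun σ => (pinnedChain ω₂ 0 0 1).bondCurrentZ σ 0) σ))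
                ((fun σ : ChainConfig => liouvilleZ (pinnedChain ω₂ a b 1) (fun σ => (pinnedChain ω₂ 0 0 1).bondCurrentZ σ 0) σ - liouvilleZ (pinnedChain ω₂ 0 0 1) (fun σ => (pinnedChain ω₂ 0 0 1).bondCurrentZ σ 0) σ + b * (liouvilleZ (pinnedChain ω₂ 0 0 1) (fun σ => (pinnedChain ω₂ 0 1 1).bondCurrentZ σ 0) σ - liouvilleZ (pinnedChain ω₂ 0 0 1) (fun σ => (pinnedChain ω₂ 0 0 1).bondCurrentZ σ 0) σ)) ∘ D₀.flow t) =
              ∫ x, Real.cos (x * t) ∂m) ∧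
          ∃ δ : ℝ, 0 < δ ∧ ∃ ρ : ℝ → ℝ, ContinuousOn ρ (Set.Ioo (-δ) δ) ∧ (∀ x ∈ Set.Ioo (-δ) δ, 0 ≤ ρ x) ∧
            0 < ρ 0 ∧
            m.restrict (Set.Ioo (-δ) δ) = (volume.restrict (Set.Ioo (-δ) δ)).withDensity (fun x => ENNReal.ofReal (ρ x))) :
    ∀ ω₂ a b : ℝ, 0 < ω₂ → 0 < a → 0 < b → HasOddSectorGap ω₂ a b →
      ∀ (D₀ : InfiniteChainDynamics (pinnedChain ω₂ 0 0 1)) (Z₀ : ZeroWavenumberData (pinnedChain ω₂ 0 0 1) D₀),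
        (pinnedChain ω₂ 0 0 1).IsChainGibbsMeasure 1 Z₀.μ →
        D₀.carrier = (pinnedChain ω₂ 0 0 1).bmGood →
        Z₀.toFluctuationDynamics.IsStronglyContinuous →
        (fun σ : ChainConfig => liouvilleZ (pinnedChain ω₂ a b 1) (fun σ => (pinnedChain ω₂ 0 0 1).bondCurrentZ σ 0) σ - liouvilleZ (pinnedChain ω₂ 0 0 1) (fun σ => (pinnedChain ω₂ 0 0 1).bondCurrentZ σ 0) σ + b * (liouvilleZ (pinnedChain ω₂ 0 0 1) (fun σ => (pinnedChain ω₂ 0 1 1).bondCurrentZ σ 0) σ - liouvilleZ (pinnedChain ω₂ 0 0 1) (fun σ => (pinnedChain ω₂ 0 0 1).bondCurrentZ σ 0) σ)) ∈ Z₀.localObs →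
        ∃ δ : ℝ, 0 < δ ∧ ∃ ρ : ℝ → ℝ, ContinuousOn ρ (Set.Ioo (-δ) δ) ∧ 0 < ρ 0 ∧
          TendstoLocallyUniformlyOn
            (fun (ν : ℝ) (ω : ℝ) => ∫ t in Set.Ioi (0 : ℝ), Real.exp (-(ν * t)) * (Real.cos (ω * t) *
              Z₀.form
                (fun σ : ChainConfig => liouvilleZ (pinnedChain ω₂ a b 1) (fun σ => (pinnedChain ω₂ 0 0 1).bondCurrentZ σ 0) σ - liouvilleZ (pinnedChain ω₂ 0 0 1) (fun σ => (pinnedChain ω₂ 0 0 1).bondCurrentZ σ 0) σ + b * (liouvilleZ (pinnedChain ω₂ 0 0 1) (fun σ => (pinnedChain ω₂ 0 1 1).bondCurrentZ σ 0) σ - liouvilleZ (pinnedChain ω₂ 0 0 1) (fun σ => (pinnedChain ω₂ 0 0 1).bondCurrentZ σ 0) σ))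
                ((fun σ : ChainConfig => liouvilleZ (pinnedChain ω₂ a b 1) (fun σ => (pinnedChain ω₂ 0 0 1).bondCurrentZ σ 0) σ - liouvilleZ (pinnedChain ω₂ 0 0 1) (fun σ => (pinnedChain ω₂ 0 0 1).bondCurrentZ σ 0) σ + b * (liouvilleZ (pinnedChain ω₂ 0 0 1) (fun σ => (pinnedChain ω₂ 0 1 1).bondCurrentZ σ 0) σ - liouvilleZ (pinnedChain ω₂ 0 0 1) (fun σ => (pinnedChain ω₂ 0 0 1).bondCurrentZ σ 0) σ)) ∘ D₀.flow t)))
            (fun ω => Real.pi * ρ ω) (𝓝[>] (0 : ℝ)) (Set.Ioo (-δ) δ) := by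
  intro ω₂ a b hω ha hb hgap D₀ Z₀ hG hcar hsc hΦ
  obtain ⟨m, hm, hK, δ, hδ, ρ, hρc, hρ0, hρ00, hwin⟩ := hres ω₂ a b hω ha hb hgap D₀ Z₀ hG hcar hsc hΦ
  refine ⟨δ, hδ, fun ω => (ρ ω + ρ (-ω)) / 2, ?_, ?_, ?_⟩
  · refine (hρc.add (hρc.comp continuous_neg.continuousOn ?_)).div_const 2
    intro ω hω
    exact ⟨by linarith [hω.2], by linarith [hω.1]⟩
  · simp only [neg_zero]
    linarith
  · exact tendstoLocallyUniformlyOn_abelCos_of_window m hm _ hK δ hδ ρ hρc hρ0 hwin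

end Summit.AtomisticToContinuum.FouriersLaw.Theorems.DrudeDissolution.GramPencilHarmonicChaos

end
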